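import Summits.KontsevichZagierPeriods.KontsevichZagierPeriods.Theses.IsogenyCertificates
import Summits.KontsevichZagierPeriods.KontsevichZagierPeriods.Theorems.IsogenyCertificatesXMapKernelCellsUnconditional

/-!
# `EllipticPeriodCells` (stmt-KontsevichZagierPeriods-18264, route IsogenyCertificates): proved

The support item books the two sector theorems produced by the crux `XMapKernel` as deliverables of the
route:

* (i) the REAL-PERIOD CELL — every value-`0` formal `ℤ`-combination of the real-period representations
  `[{x³+Ax+B>0}, a/√(x³+Ax+B)]` (`(A,B) ∈ ℤ²` nonsingular, `a ∈ ℚ`) is a relation of the four-move KZ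
  calculus: `XMapKernelCells.realPeriodCellKernel_relations`;
* (ii) the (ω, η)-EGG CELL — the same for the egg representations `[egg(A,B), (a₀+a₁x)/√(x³+Ax+B)]`
  (`4A³+27B² < 0`): `XMapKernelCells.etaCellKernel_holds`.

Both are unconditional theorems of the tree
(`Theorems/IsogenyCertificatesXMapKernelCellsUnconditional.lean`, where the Huber–Wüstholz many-curve period
theorem is discharged by `HuberWustholzManyCurvePeriods_holds`); this file is the pairing, nothing else.
Sources: Kontsevich–Zagier 2001 §1.2; Huber–Wüstholz 2022 Thm. 15.3.
-/

namespace Summit.KontsevichZagierPeriods.IsogenyCertificates.EllipticPeriodCells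

/-- **`EllipticPeriodCells` holds**: the real-period cell and the (ω, η)-egg cell of the elliptic sector are
relations of the KZ calculus — the conjunction of `XMapKernelCells.realPeriodCellKernel_relations` and
`XMapKernelCells.etaCellKernel_holds`. [cite: KontsevichZagier2001, §1.2] -/
theorem EllipticPeriodCells_proof :
    Summit.KontsevichZagierPeriods.KontsevichZagierPeriods.Theses.IsogenyCertificates.EllipticPeriodCells := by
  unfold Summit.KontsevichZagierPeriods.KontsevichZagierPeriods.Theses.IsogenyCertificates.EllipticPeriodCells
  exact ⟨XMapKernelCells.realPeriodCellKernel_relations, XMapKernelCells.etaCellKernel_holds⟩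

end Summit.KontsevichZagierPeriods.IsogenyCertificates.EllipticPeriodCells
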